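import Summits.CriticalPhenomena.PercolationContinuityZ3.Theorems.PercNearOneGluingNoHeavyLowerTailFKQSensitivityWitnesses
import HarnessLib

/-!
# `q = 1/2`: the conditioned slack hierarchy FAILS — `¬ FK.CSHFK (1/2)` (sharpness of `FK.cshFK_of_one_le`)

Helper file (`--supports stmt-CriticalPhenomena-4575 --as helper`), FK sub-lane `prim-bschramm-fk-3` ("locate the `q`-sensitivity");
builds on p205010 (kernel theorem, internal audit signed; external expert review pending).  No named facts, no sorries; standard axioms;
exact rationals decided by the kernel through the bridge `FK.RCEval` (`…FKExactEval.lean`), `64` configurations.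

`FK.CSHFK q` is memo Theorem 1 (the conditioned slack hierarchy CSH(Y; x; D; o, v), every level, every monotone functional of the
owner's open edge cluster) for `φ_{w,q}` with NON-DEGENERATE parameters on all pairs; `FK.cshFK_of_one_le : 1 ≤ q → CSHFK q` (fk-1 g3)
closed the finite leg for `q ≥ 1`.  The docstring of `FK.CSHFKMonotone` records the census finding "for `q < 1` the statement is FALSE at
the edge level".  Kernel witness (this seat's `work/k6search.py` / `work/k3lcheck.py`; it is the level-`0` cell CSH(∅; 0; ∅; 1, 2) =
the (K6) cell of `…FKCovTransferSharpness.lean` with `S = {x}`): the triangle `K₃` with ALL SIX pairs of `Sym2 (Fin 3)` listed — the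
edges `01, 02, 12` AND the loops `00, 11, 22` — at parameter `1/2` (loops never change connectivity, cluster counts or open edge clusters;
they only make the parameter vector non-degenerate), `q = 1/2`, owner `x = 0`, `Y = ∅`, no decoys, observers `o = 1`, `v = 2`,
`f = 1{02 ∈ C_0}`:
  `covD(f,1) = φ(02, 0↔1) − φ(02)φ(0↔1) = 12/23 − (14/23)(18/23) = 24/529`,  `covD(f,2) = 14/23 − (14/23)(18/23) = 70/529`,
  `p = φ(2↮0, 1↔2)/φ(2↮0) = (2/23)/(5/23) = 2/5`,  margin `= 24/529 − (2/5)(70/529) = −4/529 < 0`  (`FK.not_cshFK_half`).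
So `1 ≤ q` in `FK.cshFK_of_one_le` is sharp: the hierarchy itself (not only its inputs) is a `q ≥ 1` phenomenon, in contrast with the
census-true-for-all-`q` output `FK.AdditiveGluingFK` (`FK.AdditiveGluingFKPos`).
[cite: VandenbergHaggstromKahn2005, §2.1 (pp. 9–13)] [cite: Grimmett2006, Thm. (3.8) and §3.9]
-/

namespace Summit.CriticalPhenomena.PercolationContinuityZ3.Theorems

namespace FK

open MeasureTheory Literature.Probability.LatticeModels Literature.Probability.Percolation

namespace QSensitivity

/-! ### The data: `K₃` with its loops, all six pairs at parameter `1/2` -/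

/-- `K₃` on `Fin 3` with ALL pairs listed: `01, 02, 12` (indices `0,1,2`) and the loops `00, 11, 22` (indices `3,4,5`), parameters `1/2`,
cluster weight `q` (reducible). (transcription of bschramm/FK-BARRIER.md §9) -/
abbrev k3l (q : ℚ) : RCEval := ⟨3, 6, ![0, 0, 1, 0, 1, 2], ![1, 2, 2, 0, 1, 2], fun _ => 1 / 2, q⟩

/-! ### Kernel arithmetic (`decide +kernel`, 64 configurations each) -/

/-- Validity at `q = 1/2`. [folklore] -/
theorem k3l_half_valid : (k3l (1 / 2)).Valid := by decide +kernel

/-- Every pair of `Sym2 (Fin 3)` is listed. [folklore] -/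
theorem k3l_edge_surj : ∀ e : Sym2 (Fin 3), ∃ i : Fin 6, (k3l (1 / 2)).edge i = e := by decide

/-- `Z = 23/64` (the loops contribute a factor `1`). (transcription of bschramm/FK-BARRIER.md §9) -/
theorem zq_k3l : (k3l (1 / 2)).ZQ = 23 / 64 := by decide +kernel

/-- Mass of `{02 open}`: `7/32`. (transcription of bschramm/FK-BARRIER.md §9) -/
theorem mass_k3l_e : (k3l (1 / 2)).massQ (fun t => decide ((1 : Fin 6) ∈ t)) = 7 / 32 := by decide +kernel

/-- Mass of `{0 ↔ 1} ∩ {02 open}`: `3/16`. (transcription of bschramm/FK-BARRIER.md §9) -/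
theorem mass_k3l_c01_e :
    (k3l (1 / 2)).massQ (fun t => (k3l (1 / 2)).reachB t 0 1 && decide ((1 : Fin 6) ∈ t)) = 3 / 16 := by decide +kernel

/-- Mass of `{0 ↔ 1}`: `9/32`. (transcription of bschramm/FK-BARRIER.md §9) -/
theorem mass_k3l_c01 : (k3l (1 / 2)).massQ (fun t => (k3l (1 / 2)).reachB t 0 1) = 9 / 32 := by decide +kernel

/-- Mass of `{0 ↔ 2} ∩ {02 open}`: `7/32`. (transcription of bschramm/FK-BARRIER.md §9) -/
theorem mass_k3l_c02_e :
    (k3l (1 / 2)).massQ (fun t => (k3l (1 / 2)).reachB t 0 2 && decide ((1 : Fin 6) ∈ t)) = 7 / 32 := by decide +kernel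

/-- Mass of `{0 ↔ 2}`: `9/32`. (transcription of bschramm/FK-BARRIER.md §9) -/
theorem mass_k3l_c02 : (k3l (1 / 2)).massQ (fun t => (k3l (1 / 2)).reachB t 0 2) = 9 / 32 := by decide +kernel

/-- Mass of `{2 ↮ 0} ∩ {1 ↔ 2}`: `1/32`. (transcription of bschramm/FK-BARRIER.md §9) -/
theorem mass_k3l_D_ov :
    (k3l (1 / 2)).massQ (fun t => !((k3l (1 / 2)).reachB t 2 0) && (k3l (1 / 2)).reachB t 1 2) = 1 / 32 := by decide +kernel

/-- Mass of `{2 ↮ 0}`: `5/64`. (transcription of bschramm/FK-BARRIER.md §9) -/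
theorem mass_k3l_D : (k3l (1 / 2)).massQ (fun t => !((k3l (1 / 2)).reachB t 2 0)) = 5 / 64 := by decide +kernel

/-! ### From masses to the measure -/

noncomputable section

open scoped Classical

/-- The measure `φ = φ_{K₃ with loops, 1/2, q = 1/2}`. [cite: Grimmett2006, §1.4 eq. (1.20) (p. 15)] -/
abbrev φl : Measure (BondConfig (Fin 3)) := rcMeasureW (k3l (1 / 2)).w (1 / 2) ∅

/-- `(k3l (1/2)).q = 1/2` as a real number. [folklore] -/
theorem k3l_half_q : (((k3l (1 / 2)).q : ℚ) : ℝ) = 1 / 2 := by norm_num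

/-- **Non-degeneracy**: every pair, loops included, has parameter `1/2 ∈ (0,1)`. [folklore] -/
theorem k3l_w_nondeg : ∀ e : Sym2 (Fin 3), 0 < (k3l (1 / 2)).w e ∧ (k3l (1 / 2)).w e < 1 := by
  intro e
  obtain ⟨i, rfl⟩ := k3l_edge_surj e
  have h : ((k3l (1 / 2)).w ((k3l (1 / 2)).edge i) : ℝ) = 1 / 2 := by
    rw [RCEval.w_edge k3l_half_valid i]; norm_num
  constructor
  · exact Subtype.coe_lt_coe.1 (by rw [h]; norm_num)
  · exact Subtype.coe_lt_coe.1 (by rw [h]; norm_num)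

/-- The functional `f = 1{02 ∈ C}` (increasing). [folklore] -/
def f02 (C : Set (Sym2 (Fin 3))) : ℝ := if s((0 : Fin 3), 2) ∈ C then 1 else 0

/-- `f02` is monotone. [folklore] -/
theorem f02_mono : Monotone f02 := by
  intro S T hST
  unfold f02
  by_cases hS : s((0 : Fin 3), 2) ∈ S
  · rw [if_pos hS, if_pos (hST hS)]
  · rw [if_neg hS]; split_ifs <;> norm_num

/-- On `conf t`, `f02(C_0) = [02 open] = [1 ∈ t]`. [cite: VandenbergHaggstromKahn2005, §1 p. 3 (definition of C_s)] -/
theorem f02_conf (t : Finset (Fin 6)) :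
    f02 (openEdgeCluster ((k3l (1 / 2)).conf t) 0) = if decide ((1 : Fin 6) ∈ t) then (1 : ℝ) else 0 := by
  have h02 : s((0 : Fin 3), 2) ∈ openEdgeCluster ((k3l (1 / 2)).conf t) 0 ↔ decide ((1 : Fin 6) ∈ t) = true := by
    rw [mk_mem_openEdgeCluster_iff _ (by decide), decide_eq_true_iff,
      show s((0 : Fin 3), 2) = (k3l (1 / 2)).edge 1 from rfl, RCEval.edge_mem_conf k3l_half_valid]
  unfold f02
  by_cases ht : decide ((1 : Fin 6) ∈ t) = true
  · rw [if_pos (h02.2 ht), if_pos ht]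
  · rw [if_neg (fun h' => ht (h02.1 h')), if_neg ht]

/-- A restricted integral of `f02(C_0)` as a mass: `∫_X f02(C_0) dφ = massQ (P ∧ [1 ∈ ·]) / ZQ` for `conf t ∈ X ↔ P t`. [folklore] -/
theorem setIntegral_f02 {X : Set (BondConfig (Fin 3))} {P : Finset (Fin 6) → Bool} (hP : ∀ t, (k3l (1 / 2)).conf t ∈ X ↔ P t = true) :
    ∫ ω in X, f02 (openEdgeCluster ω 0) ∂φl =
      (((k3l (1 / 2)).massQ (fun t => P t && decide ((1 : Fin 6) ∈ t)) : ℚ) : ℝ) / (((k3l (1 / 2)).ZQ : ℚ) : ℝ) := by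
  have h1 := RCEval.setIntegral_eq_sum_div k3l_half_valid (fun ω => f02 (openEdgeCluster ω 0)) hP
  rw [k3l_half_q] at h1
  rw [h1, ← RCEval.sum_mQ_mul_ite (D := k3l (1 / 2)) (P := fun t => P t && decide ((1 : Fin 6) ∈ t))]
  congr 1
  refine Finset.sum_congr rfl fun t _ => ?_
  rw [f02_conf]
  cases P t <;> cases decide ((1 : Fin 6) ∈ t) <;> simp

/-- `∫ f02(C_0) dφ = 14/23`. (transcription of bschramm/FK-BARRIER.md §9) -/
theorem integral_f02 : ∫ ω, f02 (openEdgeCluster ω 0) ∂φl = 14 / 23 := by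
  rw [← Measure.restrict_univ (μ := φl), setIntegral_f02 (P := fun _ => true) (fun t => by simp)]
  have h : (k3l (1 / 2)).massQ (fun t => true && decide ((1 : Fin 6) ∈ t)) = (k3l (1 / 2)).massQ (fun t => decide ((1 : Fin 6) ∈ t)) := by
    simp only [Bool.true_and]
  rw [h, mass_k3l_e, zq_k3l]; norm_num

/-- `conf t ∈ {0 ↔ u}` is computed by `reachB`. [folklore] -/
theorem k3l_conf_mem_conn (u : Fin 3) (t : Finset (Fin 6)) :
    (k3l (1 / 2)).conf t ∈ openConn (0 : Fin 3) u ↔ (k3l (1 / 2)).reachB t 0 u = true := by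
  rw [RCEval.reachB_iff]; rfl

/-- `∫_{0↔1} f02(C_0) dφ = 12/23`. (transcription of bschramm/FK-BARRIER.md §9) -/
theorem setIntegral_f02_c01 : ∫ ω in openConn (0 : Fin 3) 1, f02 (openEdgeCluster ω 0) ∂φl = 12 / 23 := by
  rw [setIntegral_f02 (k3l_conf_mem_conn 1), mass_k3l_c01_e, zq_k3l]; norm_num

/-- `∫_{0↔2} f02(C_0) dφ = 14/23`. (transcription of bschramm/FK-BARRIER.md §9) -/
theorem setIntegral_f02_c02 : ∫ ω in openConn (0 : Fin 3) 2, f02 (openEdgeCluster ω 0) ∂φl = 14 / 23 := by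
  rw [setIntegral_f02 (k3l_conf_mem_conn 2), mass_k3l_c02_e, zq_k3l]; norm_num

/-- `φ(0 ↔ 1) = 18/23`. (transcription of bschramm/FK-BARRIER.md §9) -/
theorem real_k3l_c01 : φl.real (openConn (0 : Fin 3) 1) = 18 / 23 := by
  have h := RCEval.real_eq_massQ_div k3l_half_valid (k3l_conf_mem_conn 1)
  rw [mass_k3l_c01, zq_k3l, k3l_half_q] at h
  rw [h]; norm_num

/-- `φ(0 ↔ 2) = 18/23`. (transcription of bschramm/FK-BARRIER.md §9) -/
theorem real_k3l_c02 : φl.real (openConn (0 : Fin 3) 2) = 18 / 23 := by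
  have h := RCEval.real_eq_massQ_div k3l_half_valid (k3l_conf_mem_conn 2)
  rw [mass_k3l_c02, zq_k3l, k3l_half_q] at h
  rw [h]; norm_num

/-- `φ(2 ↮ 0) = 5/23`. (transcription of bschramm/FK-BARRIER.md §9) -/
theorem real_k3l_D : φl.real {ω : BondConfig (Fin 3) | ¬ (openGraph ω).Reachable 2 0} = 5 / 23 := by
  have h := RCEval.real_eq_massQ_div k3l_half_valid (X := {ω : BondConfig (Fin 3) | ¬ (openGraph ω).Reachable 2 0})
    (P := fun t => !((k3l (1 / 2)).reachB t 2 0)) (fun t => by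
      rw [Bool.not_eq_true', ← Bool.not_eq_true, RCEval.reachB_iff]; rfl)
  rw [mass_k3l_D, zq_k3l, k3l_half_q] at h
  rw [h]; norm_num

/-- `φ(2 ↮ 0, 1 ↔ 2) = 2/23`. (transcription of bschramm/FK-BARRIER.md §9) -/
theorem real_k3l_D_ov : φl.real ({ω : BondConfig (Fin 3) | ¬ (openGraph ω).Reachable 2 0} ∩ openConn 1 2) = 2 / 23 := by
  have h := RCEval.real_eq_massQ_div k3l_half_valid
    (X := {ω : BondConfig (Fin 3) | ¬ (openGraph ω).Reachable 2 0} ∩ openConn 1 2)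
    (P := fun t => !((k3l (1 / 2)).reachB t 2 0) && (k3l (1 / 2)).reachB t 1 2) (fun t => by
      rw [Set.mem_inter_iff, Bool.and_eq_true, Bool.not_eq_true', ← Bool.not_eq_true, RCEval.reachB_iff, RCEval.reachB_iff]; rfl)
  rw [mass_k3l_D_ov, zq_k3l, k3l_half_q] at h
  rw [h]; norm_num

/-- The level-`0` conditional covariance with no avoided set, `u = 1`: `covD(f02, 1) = 24/529`. (transcription of bschramm/FK-BARRIER.md §9) -/
theorem covD_f02_one : covDμ φl 0 (∅ : Set (Fin 3)) f02 1 = 24 / 529 := by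
  haveI : IsProbabilityMeasure φl := isProbabilityMeasure_rcMeasureW _ (by norm_num) ∅
  have hU : {ω : BondConfig (Fin 3) | ∀ y ∈ (∅ : Set (Fin 3)), ¬ (openGraph ω).Reachable 0 y} = Set.univ :=
    Set.eq_univ_of_forall fun ω y hy => (Set.notMem_empty y hy).elim
  unfold covDμ
  rw [hU, Set.univ_inter, Measure.restrict_univ, probReal_univ, setIntegral_f02_c01, integral_f02, real_k3l_c01]
  norm_num

/-- The level-`0` conditional covariance with no avoided set, `u = 2`: `covD(f02, 2) = 70/529`. (transcription of bschramm/FK-BARRIER.md §9) -/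
theorem covD_f02_two : covDμ φl 0 (∅ : Set (Fin 3)) f02 2 = 70 / 529 := by
  haveI : IsProbabilityMeasure φl := isProbabilityMeasure_rcMeasureW _ (by norm_num) ∅
  have hU : {ω : BondConfig (Fin 3) | ∀ y ∈ (∅ : Set (Fin 3)), ¬ (openGraph ω).Reachable 0 y} = Set.univ :=
    Set.eq_univ_of_forall fun ω y hy => (Set.notMem_empty y hy).elim
  unfold covDμ
  rw [hU, Set.univ_inter, Measure.restrict_univ, probReal_univ, setIntegral_f02_c02, integral_f02, real_k3l_c02]
  norm_num

/-- The observers' constant `p = φ(2↮0, 1↔2)/φ(2↮0) = 2/5`. (transcription of bschramm/FK-BARRIER.md §9) -/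
theorem obsConst_eq : obsConstμ φl 1 2 ({0} : Set (Fin 3)) = 2 / 5 := by
  have hA : {ω : BondConfig (Fin 3) | ∀ a ∈ ({0} : Set (Fin 3)), ¬ (openGraph ω).Reachable 2 a} =
      {ω : BondConfig (Fin 3) | ¬ (openGraph ω).Reachable 2 0} := by
    ext ω; simp only [Set.mem_setOf_eq, Set.mem_singleton_iff, forall_eq]
  unfold obsConstμ
  rw [hA, real_k3l_D_ov, real_k3l_D]
  norm_num

end

end QSensitivity

/-! ### The located statement -/

noncomputable section

open scoped Classical
open QSensitivity

/-- **THE CONDITIONED SLACK HIERARCHY FAILS for `φ_{w,q}` with `q = 1/2`: `¬ FK.CSHFK (1/2)`.**  Witness: `K₃` with all six pairs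
(loops included) at parameter `1/2` (non-degenerate), `q = 1/2`, level `0`: CSH(∅; 0; ∅; 1, 2) at `f = 1{02 ∈ C_0}` has margin
`covD(f,1) − p·covD(f,2) = 24/529 − (2/5)(70/529) = −4/529 < 0`.  So `1 ≤ q` in fk-1's `FK.cshFK_of_one_le` is sharp.
(transcription of bschramm/FK-BARRIER.md §9) [cite: VandenbergHaggstromKahn2005, §2.1 (pp. 9–13)] [cite: Grimmett2006, Thm. (3.8) and §3.9] -/
theorem not_cshFK_half : ¬ CSHFK (1 / 2) := by
  intro h
  have key := h 3 (k3l (1 / 2)).w k3l_w_nondeg 1 2 0 ∅ [] (by decide) (by simp) (by decide) (by decide) (by simp) (by simp)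
    List.nodup_nil (by simp) f02 f02_mono
  simp only [cshMarginμ, decoyListμ, CSH.cshMarg, CSH.slForm_nil, Finset.coe_empty] at key
  have hA : insert (0 : Fin 3) (∅ : Set (Fin 3)) ∪ {d | d ∈ ([] : List (Fin 3))} = ({0} : Set (Fin 3)) := by
    ext a; simp
  rw [hA, covD_f02_one, covD_f02_two, obsConst_eq] at key
  norm_num at key

end

end FK

end Summit.CriticalPhenomena.PercolationContinuityZ3.Theorems
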